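import Literature.NumberTheory.EllipticCurves.AnticyclotomicLocalNormResidueSymbolProofs
import HarnessLib

/-!
# The local norm residue symbol of `π̄/π` fixes the anticyclotomic tower — at EVERY prime, `p = 2` included

Topic `NumberTheory/EllipticCurves` (Iwasawa theory of `ℤ_p`-extensions); namespace
`Literature.NumberTheory.EllipticCurves.ZpExtension`. THEOREMS ONLY (no definition, no named fact, no instance;
D-0026). Sequel of `AnticyclotomicLocalNormResidueSymbolProofs`, whose §6 discharges the named fact
`ZpExtension.exists_isFrobPow_mem_kerSubgroup_of_isAnticyclotomic` — a statement that CARRIES the guard `p ≠ 2`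
although its proof never uses it (the binder `_hp2` is dead in `…_holds`: clause (ii) is `2·κ(res σ) = 0` in the
torsion-free `ℤ_p`, valid at `p = 2`; clauses (i) and (iii) are prime-free local class field theory).

* `exists_isFrobPow_mem_kerSubgroup_of_isAnticyclotomic_anyPrime` — the SAME three clauses WITHOUT `p ≠ 2`:
  for `K` imaginary quadratic, any prime `p`, `v ∣ p` of degree one, `v^h = (π)` (`h ≥ 1`): there is
  `σ ∈ Γ_{K_v}` (a lift of Serre's norm residue symbol `θ_v(c(π)/π)`) with (i) Frobenius degree `h`,
  (ii) `res_v σ ∈ ker κ` for EVERY anticyclotomic `ℤ_p`-extension `κ`, (iii) cyclotomic character `p^{2h}/π²`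
  (`ε_p(res_v σ) ≡ m (mod p^n)` whenever `m·π² ≡ p^{2h} (mod v^{n+2h})`).  Proof = §6 of the predecessor verbatim
  (its public bricks `deg_eq_of_canonicalArtin_eq`, `absGaloisRestrict_toAbsGalois_mem_kerSubgroup`,
  `toZModPow_cyclotomicCharacter_eq`), with the two file-private quadratic-field helpers re-derived here.

WHY (seat bsd-line-cf2-p1-w2 g4, crux stmt-BirchSwinnertonDyer-20368 `PrintCf2.SplitBadTwoRankOneOfFacts`, line
`eisenstein_two_bdp_line` v8, stub `stub_finLoc_two`): the local-tower torsion-finiteness atom at `p = 2` on the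
split-bad CM class is reduced by `Theorems/LocalTowerTorsionFiniteOfTwoStableLines` to two stable lines plus ONE element
of `D_𝔭 ⊓ ker κ` moving both; this `σ` is that element at `p = 2` (its scalars on the CM lines are `u₀^{±h}`-type,
never `1` by archimedean size). BSD is not proved by any of this.

## References

* J. Tate, *Global class field theory*, Ch. VII of Cassels–Fröhlich (1967), §4.2, Prop. 6.2. [CasselsFrohlichANT1967]
* J.-P. Serre, *Local class field theory*, ibid. Ch. VI, §3.1 Thm. 2. [SerreLCFT1967]
* D. Brink, *Prime decomposition in the anti-cyclotomic extension*, Math. Comp. 76 (2007), §II Prop. 1. [Brink2007]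
-/

noncomputable section

open scoped ComplexConjugate
open Field NumberField IsDedekindDomain

namespace Literature.NumberTheory.EllipticCurves.ZpExtension

open Literature.NumberTheory.GaloisRepresentations Literature.NumberTheory.Automorphic

section Quadratic

variable {K : Type} [Field K] [NumberField K]

/-- **A quadratic field has a non-trivial automorphism** (`#Gal(K/ℚ) = 2`). [folklore] -/
private theorem exists_algEquiv_ne_one_of_finrank_two (hK2 : Module.finrank ℚ K = 2) : ∃ c : K ≃ₐ[ℚ] K, c ≠ 1 := by
  haveI : Algebra.IsQuadraticExtension ℚ K := ⟨hK2⟩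
  have hcard : Fintype.card (K ≃ₐ[ℚ] K) = 2 := by
    rw [← Nat.card_eq_fintype_card, IsGalois.card_aut_eq_finrank, hK2]
  by_contra h
  push Not at h
  have h1 : Fintype.card (K ≃ₐ[ℚ] K) ≤ 1 := Fintype.card_le_one_iff.mpr fun a b => by rw [h a, h b]
  omega

/-- Every automorphism of a quadratic field is `1` or the non-trivial one. [folklore] -/
private theorem algEquiv_eq_one_or_eq_of_finrank_two (hK2 : Module.finrank ℚ K = 2) {c : K ≃ₐ[ℚ] K} (hc : c ≠ 1)
    (σ : K ≃ₐ[ℚ] K) : σ = 1 ∨ σ = c := by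
  classical
  haveI : Algebra.IsQuadraticExtension ℚ K := ⟨hK2⟩
  have hcard : Fintype.card (K ≃ₐ[ℚ] K) = 2 := by
    rw [← Nat.card_eq_fintype_card, IsGalois.card_aut_eq_finrank, hK2]
  by_contra h
  push Not at h
  obtain ⟨h1, h2⟩ := h
  have h3 : ({1, c, σ} : Finset (K ≃ₐ[ℚ] K)).card = 3 := by
    rw [Finset.card_insert_of_notMem, Finset.card_pair (Ne.symm h2)]
    simp only [Finset.mem_insert, Finset.mem_singleton, not_or]
    exact ⟨Ne.symm hc, Ne.symm h1⟩
  have h4 := Finset.card_le_univ ({1, c, σ} : Finset (K ≃ₐ[ℚ] K))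
  rw [h3, hcard] at h4
  omega

/-- **A degree-one prime of a quadratic field is moved by the non-trivial automorphism**: `∑_{u ∣ p} e_u f_u = 2` with
`e_v f_v = 1` leaves a second place, which is `c v` by transitivity of `Gal(K/ℚ)` on the places above `p` (verbatim the
predecessor's file-private `smul_ne_self_of_degree_one`). [folklore] -/
private theorem smul_ne_self_of_degree_one' (hK2 : Module.finrank ℚ K = 2) {c : K ≃ₐ[ℚ] K} (hc : c ≠ 1)
    {v : HeightOneSpectrum (𝓞 K)}
    (he : v.asIdeal.ramificationIdx (𝓞 ℚ) = 1) (hf : v.asIdeal.inertiaDeg (𝓞 ℚ) = 1) :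
    c • v ≠ v := by
  classical
  haveI : Algebra.IsQuadraticExtension ℚ K := ⟨hK2⟩
  intro hcv
  -- every place above `(p)` is `v`
  set P : Ideal (𝓞 ℚ) := (v.under (𝓞 ℚ)).asIdeal with hP
  haveI hPmax : P.IsMaximal := (v.under (𝓞 ℚ)).isMaximal
  have hall : ∀ 𝔓 : P.primesOver (𝓞 K), (𝔓 : Ideal (𝓞 K)) = v.asIdeal := by
    intro 𝔓
    have h𝔓ne : (𝔓 : Ideal (𝓞 K)) ≠ ⊥ := by
      haveI : (𝔓 : Ideal (𝓞 K)).IsPrime := 𝔓.2.1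
      haveI : (𝔓 : Ideal (𝓞 K)).LiesOver P := 𝔓.2.2
      exact Ideal.ne_bot_of_liesOver_of_ne_bot (Ring.ne_bot_of_isMaximal_of_not_isField hPmax
        (RingOfIntegers.not_isField ℚ)) (𝔓 : Ideal (𝓞 K))
    set u : HeightOneSpectrum (𝓞 K) := ⟨𝔓, 𝔓.2.1, h𝔓ne⟩ with hu
    have huv : u.under (𝓞 ℚ) = v.under (𝓞 ℚ) := by
      apply HeightOneSpectrum.ext
      rw [HeightOneSpectrum.under_asIdeal, HeightOneSpectrum.under_asIdeal]
      exact 𝔓.2.2.over.symm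
    obtain ⟨σ, hσ⟩ := HeightOneSpectrum.exists_algEquiv_smul_eq (F := ℚ) (huv.symm)
    rcases algEquiv_eq_one_or_eq_of_finrank_two hK2 hc σ with rfl | rfl
    · rw [one_smul] at hσ; exact congrArg HeightOneSpectrum.asIdeal hσ.symm
    · rw [hcv] at hσ; exact congrArg HeightOneSpectrum.asIdeal hσ.symm
  -- so the fundamental identity has a single term `e_v f_v = 1 ≠ 2`
  have hsum := NumberFields.sum_ramificationIdx_mul_inertiaDeg_eq_finrank_of_isMaximal ℚ K P
  rw [Algebra.IsQuadraticExtension.finrank_eq_two] at hsum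
  have hv : v.asIdeal ∈ P.primesOver (𝓞 K) :=
    ⟨v.isPrime, ⟨(HeightOneSpectrum.under_asIdeal (𝓞 ℚ) v).symm⟩⟩
  haveI : Subsingleton (P.primesOver (𝓞 K)) := ⟨fun a b => Subtype.ext ((hall a).trans (hall b).symm)⟩
  letI : Unique (P.primesOver (𝓞 K)) := uniqueOfSubsingleton ⟨v.asIdeal, hv⟩
  rw [Fintype.sum_unique] at hsum
  change v.asIdeal.ramificationIdx (𝓞 ℚ) * v.asIdeal.inertiaDeg (𝓞 ℚ) = 2 at hsum
  rw [he, hf] at hsum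
  exact absurd hsum (by norm_num)

end Quadratic

/-! ### The three clauses at every prime -/

section AnyPrime

variable (K : Type) [Field K] [NumberField K] (p : ℕ) [Fact p.Prime]

/-- **The local norm residue symbol of `c(π)/π` at a degree-one `v ∣ p` fixes every anticyclotomic `ℤ_p`-tower, has
Frobenius degree `h` and cyclotomic character `p^{2h}/π²` — for EVERY prime `p` (the named fact
`exists_isFrobPow_mem_kerSubgroup_of_isAnticyclotomic` without its unused guard `p ≠ 2`).** For `K` imaginary quadratic,
`v ∣ p` with `e = f = 1`, `h ≥ 1`, `v^h = (π)`: `σ = θ_v(c(π)/π) ∈ Γ_{K_v}` (through the Weil group, Deligne's normalisation)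
satisfies (i) `IsFrobPow σ h`, (ii) `res_v σ ∈ ker κ` for every anticyclotomic `κ` (product formula + transport by `c`:
`2·κ(res_v σ) = 0` in the torsion-free `ℤ_p` — no parity of `p` involved), (iii) `ε_p(res_v σ) ≡ m (mod p^n)` whenever
`m·π² ≡ p^{2h} (mod v^{n+2h})`. [cite: CasselsFrohlichANT1967, Ch. VII §6 Prop. 6.2, §4.2 (ii); Ch. VI §3.1 Thm. 2]
[cite: Brink2007, §II Prop. 1 (p. 2130)] -/
theorem exists_isFrobPow_mem_kerSubgroup_of_isAnticyclotomic_anyPrime (hK : IsImaginaryQuadratic K)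
    (v : HeightOneSpectrum (𝓞 K)) (hpv : ((p : ℕ) : 𝓞 K) ∈ v.asIdeal)
    (he : v.asIdeal.ramificationIdx (𝓞 ℚ) = 1) (hf : v.asIdeal.inertiaDeg (𝓞 ℚ) = 1)
    (h : ℕ) (π : 𝓞 K) (hh : 0 < h) (hπ : v.asIdeal ^ h = Ideal.span {π}) :
    ∃ σ : absoluteGaloisGroup (v.adicCompletion K),
      GaloisRepresentations.IsFrobPow σ (h : ℤ) ∧
      (∀ κ : ZpExtension K p, κ.IsAnticyclotomic →
        GaloisRepresentations.absGaloisRestrict K (v.adicCompletion K) σ ∈ κ.kerSubgroup) ∧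
      ∀ (n m : ℕ), (m : 𝓞 K) * π ^ 2 - (p : 𝓞 K) ^ (2 * h) ∈ v.asIdeal ^ (n + 2 * h) →
        PadicInt.toZModPow n
            ((GaloisRepresentations.GaloisRep.cyclotomicCharacter K p
              (GaloisRepresentations.absGaloisRestrict K (v.adicCompletion K) σ) : ℤ_[p]ˣ) :
              ℤ_[p]) = (m : ZMod (p ^ n)) := by
  classical
  have _ := hh
  haveI : Algebra.IsQuadraticExtension ℚ K := ⟨hK.1⟩
  obtain ⟨c, hc⟩ := exists_algEquiv_ne_one_of_finrank_two hK.1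
  have hcv : c • v ≠ v := smul_ne_self_of_degree_one' hK.1 hc he hf
  -- `k = c(π)/π ∈ Kˣ` and `w ∈ W_{K_v}` with `a_v(w) = k`
  have hπ0 : (π : K) ≠ 0 := by
    intro h0
    have : π = 0 := by exact_mod_cast h0
    rw [this, Ideal.span_singleton_zero] at hπ
    exact pow_ne_zero h v.ne_bot hπ
  set k : Kˣ := Units.mk0 (c (π : K) / (π : K))
    (div_ne_zero ((map_ne_zero c).mpr hπ0) hπ0) with hkdef
  have hk : (k : K) = c (π : K) / (π : K) := rfl
  obtain ⟨w, hw⟩ :=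
    (isLocalArtinMap_canonicalArtin_holds (v.adicCompletion K)).isOpenQuotientMap_artin.surjective
      (globalToLocalUnits v k)
  refine ⟨WeilGroup.toAbsGalois (v.adicCompletion K) w, ?_, fun κ hκ => ?_, fun n m hm => ?_⟩
  · -- (i)
    have hdeg := deg_eq_of_canonicalArtin_eq c hcv hπ hk hw
    have h1 := WeilGroup.isFrobPow_deg IsFrobPow.mul_holds w
    rwa [hdeg] at h1
  · -- (ii)
    exact absGaloisRestrict_toAbsGalois_mem_kerSubgroup hK hc κ hκ hpv he hf hπ hk hw
  · -- (iii)
    exact toZModPow_cyclotomicCharacter_eq hK hc hpv he hf hπ hk hw n m hm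

end AnyPrime

end Literature.NumberTheory.EllipticCurves.ZpExtension

end
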